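import Literature.NumberTheory.EllipticCurves.TateCurve.Invariants
import Literature.NumberTheory.EllipticCurves.PAdicHeightsLogProofs
import HarnessLib
/-!
# Route `ErratumRoadFive` (rung K2, `p ≥ 5`): the REG5CERT KERNEL EVALUATOR, part 1 — `5`-adic series estimates
# (`cosh` and the Tate sigma product) (cell `bsd-stepL`, seat `bsd-stepL-reg3-eng` g5; `--supports stmt-BirchSwinnertonDyer-19703`)

HONEST FRAMING: BSD is not proved by any of this; nothing here closes a crux; Schneider's non-degeneracy conjecture
(barrier `Literature.Barriers.BirchSwinnertonDyer.PAdicHeightNondegeneracy`) is asserted NOWHERE. This is the `p = 5`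
twin of the seat's `p = 3` evaluator (`…ClassRecordThreeRung62310y1HeightEvalSigma`): generic estimates in `ℚ₅` used by
the kernel certificate that discharges the attested binder `hReg : ClassClosure.RegulatorNonvanishingAt E 5` of the BC5
rung `rung_5595f1_of_regCert` (item 19703, `Theorems/ErratumRoadFiveRest3NoWitnessRung5595f1.lean`) at the NON-split
pair `(5595f1, 5)`. At the precision met there (`‖z(Q)‖₅ = 5⁻²`, so `‖w‖₅ = 5⁻⁴`) the transcendental ingredients of the
Stein–Wuthrich §4.2 height collapse to their leading terms: theorems only (0 defs, 0 facts),

* §1 `norm_coshOfSq_sub_le` — `‖ch(w) − (1 + w/2)‖₅ ≤ 5⁻⁸` for `‖w‖₅ ≤ 5⁻⁴`;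
* §2 `norm_tprod_tateSigmaSq_factor_sub_one_le` (`‖Π − 1‖ ≤ ‖q‖·‖c − 1‖`, verbatim twin of the `p = 3` lemma) and
  `norm_tateSigmaSq_coshOfSq_sub_le` — `‖σ_q²(ch(w)) − w‖₅ ≤ 5⁻⁸` for `‖q‖₅ < 1`, `‖w‖₅ ≤ 5⁻⁴`.

Part 2 (`…RegCertKernelFiveLog`): the formal logarithm to second order and the two Iwasawa logarithms unexpanded.
`Fact (Nat.Prime 5)` is a section hypothesis (Mathlib registers `2`, `3` only). References: [SteinWuthrich2013] §4.2;
[SilvermanAEC2009] IV.6.3; [Iwasawa1972PadicL] §4.4.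
-/

open scoped Classical

open Filter Topology PowerSeries IsUltrametricDist WeierstrassCurve Literature.NumberTheory.EllipticCurves
  Literature.NumberTheory.EllipticCurves.SteinWuthrich2013

namespace Summit.BirchSwinnertonDyer.Rank1Residual.X11b.RegMult.KernelCertFive

variable [Fact (Nat.Prime 5)]

/-! ### §0 Plumbing in `ℚ₅` -/

/-- Ultrametric inequality for differences. [folklore] -/
private theorem norm_sub_le_max₅ (a b : ℚ_[5]) : ‖a - b‖ ≤ max ‖a‖ ‖b‖ := by
  rw [sub_eq_add_neg, ← norm_neg b]; exact IsUltrametricDist.norm_add_le_max a (-b)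

/-- `5 ∤ n ⇒ ‖n‖₅ = 1` for an integer `n`. [folklore] -/
theorem norm_intCast_eq_one_of_not_dvd {n : ℤ} (h : ¬ (5 : ℤ) ∣ n) : ‖(n : ℚ_[5])‖ = 1 := by
  refine le_antisymm (Padic.norm_int_le_one n) (not_lt.mp fun hlt => h ?_)
  exact_mod_cast (Padic.norm_intCast_lt_one_iff (p := 5) (k := n)).mp hlt

/-- `‖(2 : ℚ₅)⁻¹‖ = 1`. [folklore] -/
theorem norm_inv_two₅ : ‖(2 : ℚ_[5])⁻¹‖ = 1 := by
  rw [norm_inv, show (2 : ℚ_[5]) = ((2 : ℤ) : ℚ_[5]) by norm_cast, norm_intCast_eq_one_of_not_dvd (by decide),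
    inv_one]

/-- `5^n ∣ k` from `‖(k : ℚ₅)‖ ≤ 5^{−n}` (`Padic.norm_int_le_pow_iff_dvd`). [folklore] -/
theorem pow_dvd_of_norm_le {k : ℤ} {n : ℕ} (h : ‖(k : ℚ_[5])‖ ≤ 1 / (5 : ℝ) ^ n) : (5 : ℤ) ^ n ∣ k := by
  have h' : ‖(k : ℚ_[5])‖ ≤ ((5 : ℕ) : ℝ) ^ (-(n : ℤ)) := by
    rw [zpow_neg, zpow_natCast, ← one_div]; exact_mod_cast h
  have := (Padic.norm_int_le_pow_iff_dvd (p := 5) k n).mp h'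
  exact_mod_cast this

/-- In `ℚ₅`, `‖x‖ < 1 ⇒ ‖x‖ ≤ 5⁻¹`. [folklore] -/
private theorem norm_le_fifth_of_norm_lt_one {x : ℚ_[5]} (hx : ‖x‖ < 1) : ‖x‖ ≤ 1 / 5 := by
  have h := norm_le_inv_of_norm_lt_one (p := 5) hx
  rw [one_div]; exact_mod_cast h

/-! ### §1 The `cosh` series `ch(w) = Σ wⁿ/(2n)!` at `‖w‖₅ ≤ 5⁻⁴` -/

/-- **Legendre at `p = 5`**: `‖1/(2n)!‖₅ ≤ 5ⁿ` (`4·v₅((2n)!) = 2n − s₅(2n) ≤ 2n`). [Silverman AEC IV.6.3(a)] [folklore] -/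
private theorem norm_inv_factorial_le (n : ℕ) : ‖(((2 * n).factorial : ℕ) : ℚ_[5])⁻¹‖ ≤ (5 : ℝ) ^ n := by
  have hf : ((2 * n).factorial : ℕ) ≠ 0 := Nat.factorial_ne_zero _
  rw [norm_inv, Padic.norm_eq_zpow_neg_valuation (by exact_mod_cast hf), Padic.valuation_natCast, zpow_neg,
    inv_inv, zpow_natCast]
  have hv : padicValNat 5 (2 * n).factorial ≤ n := by
    have h := sub_one_mul_padicValNat_factorial (p := 5) (2 * n)
    have hs : (5 - 1) * padicValNat 5 (2 * n).factorial ≤ 2 * n := by rw [h]; exact Nat.sub_le _ _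
    omega
  exact_mod_cast Nat.pow_le_pow_right (by norm_num) hv

/-- The general term of `coshOfSq w` has norm `≤ 5^{−3n}` for `‖w‖₅ ≤ 5⁻⁴`. [folklore] -/
private theorem norm_coshOfSq_term_le {w : ℚ_[5]} (hw : ‖w‖ ≤ 1 / 625) (n : ℕ) :
    ‖w ^ n / (((2 * n).factorial : ℕ) : ℚ_[5])‖ ≤ (1 / 125 : ℝ) ^ n := by
  rw [div_eq_mul_inv, norm_mul, norm_pow]
  calc ‖w‖ ^ n * ‖(((2 * n).factorial : ℕ) : ℚ_[5])⁻¹‖ ≤ (1 / 625 : ℝ) ^ n * (5 : ℝ) ^ n := by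
        gcongr; exact norm_inv_factorial_le n
    _ = (1 / 125 : ℝ) ^ n := by rw [← mul_pow]; norm_num

/-- `coshOfSq` converges at `‖w‖₅ ≤ 5⁻⁴` (geometric majorant `125⁻ⁿ`). [folklore] -/
theorem summable_coshOfSq_term {w : ℚ_[5]} (hw : ‖w‖ ≤ 1 / 625) :
    Summable fun n : ℕ ↦ w ^ n / (((2 * n).factorial : ℕ) : ℚ_[5]) := by
  refine Summable.of_norm_bounded (summable_geometric_of_lt_one (by norm_num) (by norm_num : (1 / 125 : ℝ) < 1)) ?_
  intro n; exact norm_coshOfSq_term_le hw n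

/-- **`‖ch(w) − (1 + w/2)‖₅ ≤ 5⁻⁸` for `‖w‖₅ ≤ 5⁻⁴`**: split off the terms `n ≤ 3`; `‖w²/24‖ = ‖w‖² ≤ 5⁻⁸`,
`‖w³/720‖ = 5‖w‖³ ≤ 5⁻¹¹`, every later term `≤ 125⁻ⁿ ≤ 5⁻¹²` (ultrametric `tsum` bound). [folklore] -/
theorem norm_coshOfSq_sub_le {w : ℚ_[5]} (hw : ‖w‖ ≤ 1 / 625) :
    ‖coshOfSq w - (1 + w / 2)‖ ≤ 1 / 5 ^ 8 := by
  have hs := summable_coshOfSq_term hw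
  have hsplit := hs.sum_add_tsum_nat_add 4
  have hdef : coshOfSq w = ∑' n : ℕ, w ^ n / (((2 * n).factorial : ℕ) : ℚ_[5]) := by rw [coshOfSq]
  rw [hdef, ← hsplit]
  simp only [Finset.sum_range_succ, Finset.sum_range_zero, zero_add, pow_zero, Nat.mul_zero, Nat.factorial_zero,
    Nat.cast_one, div_one, pow_one]
  have h2 : (((2 * 1).factorial : ℕ) : ℚ_[5]) = 2 := by norm_num [Nat.factorial]
  have h24 : (((2 * 2).factorial : ℕ) : ℚ_[5]) = 24 := by norm_num [Nat.factorial]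
  have h720 : (((2 * 3).factorial : ℕ) : ℚ_[5]) = 720 := by norm_num [Nat.factorial]
  rw [h2, h24, h720]
  have hring : 1 + w / 2 + w ^ 2 / 24 + w ^ 3 / 720 +
      ∑' n : ℕ, w ^ (n + 4) / (((2 * (n + 4)).factorial : ℕ) : ℚ_[5]) - (1 + w / 2) =
      w ^ 2 / 24 + (w ^ 3 / 720 + ∑' n : ℕ, w ^ (n + 4) / (((2 * (n + 4)).factorial : ℕ) : ℚ_[5])) := by ring
  rw [hring]
  refine (IsUltrametricDist.norm_add_le_max _ _).trans (max_le ?_ ?_)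
  · -- the quadratic term: `5 ∤ 24`
    have h24n : ‖((24 : ℚ_[5]))⁻¹‖ = 1 := by
      rw [norm_inv, show (24 : ℚ_[5]) = ((24 : ℤ) : ℚ_[5]) by norm_cast, norm_intCast_eq_one_of_not_dvd (by decide),
        inv_one]
    rw [div_eq_mul_inv, norm_mul, norm_pow, h24n, mul_one]
    calc ‖w‖ ^ 2 ≤ (1 / 625 : ℝ) ^ 2 := by gcongr
      _ = 1 / 5 ^ 8 := by norm_num
  refine (IsUltrametricDist.norm_add_le_max _ _).trans (max_le ?_ ?_)
  · -- the cubic term: `‖1/720‖₅ = 5`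
    have h720n : ‖((720 : ℚ_[5]))⁻¹‖ = 5 := by
      rw [norm_inv, show (720 : ℚ_[5]) = ((720 : ℕ) : ℚ_[5]) by norm_cast,
        Padic.norm_eq_zpow_neg_valuation (by norm_num), Padic.valuation_natCast]
      have : padicValNat 5 720 = 1 := by
        have h1 : 1 ≤ padicValNat 5 720 := (padicValNat_dvd_iff_le (by norm_num)).mp (by norm_num)
        have h2 : ¬ 2 ≤ padicValNat 5 720 := fun h => by
          have := (padicValNat_dvd_iff_le (p := 5) (n := 2) (by norm_num : (720 : ℕ) ≠ 0)).mpr h; norm_num at this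
        omega
      rw [this]; norm_num
    rw [div_eq_mul_inv, norm_mul, norm_pow, h720n]
    calc ‖w‖ ^ 3 * 5 ≤ (1 / 625 : ℝ) ^ 3 * 5 := by gcongr
      _ ≤ 1 / 5 ^ 8 := by norm_num
  · refine IsUltrametricDist.norm_tsum_le_of_forall_le_of_nonneg (by norm_num) fun n ↦ ?_
    refine (norm_coshOfSq_term_le hw (n + 4)).trans ?_
    calc (1 / 125 : ℝ) ^ (n + 4) = (1 / 125) ^ n * (1 / 125) ^ 4 := by rw [pow_add]
      _ ≤ 1 * (1 / 125) ^ 4 := by gcongr; exact pow_le_one₀ (by norm_num) (by norm_num)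
      _ ≤ 1 / 5 ^ 8 := by norm_num

/-- Corollaries at `‖w‖₅ ≤ 5⁻⁴`: `‖ch(w) − 1‖₅ ≤ 5⁻⁴` and `‖ch(w)‖₅ ≤ 1`. [folklore] -/
theorem norm_coshOfSq_sub_one_le {w : ℚ_[5]} (hw : ‖w‖ ≤ 1 / 625) :
    ‖coshOfSq w - 1‖ ≤ 1 / 625 ∧ ‖coshOfSq w‖ ≤ 1 := by
  have h := norm_coshOfSq_sub_le hw
  have hw2 : ‖w / 2‖ ≤ 1 / 625 := by rw [div_eq_mul_inv, norm_mul, norm_inv_two₅, mul_one]; exact hw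
  have h1 : ‖coshOfSq w - 1‖ ≤ 1 / 625 := by
    have : coshOfSq w - 1 = (coshOfSq w - (1 + w / 2)) + w / 2 := by ring
    rw [this]
    refine (IsUltrametricDist.norm_add_le_max _ _).trans (max_le (h.trans (by norm_num)) hw2)
  refine ⟨h1, ?_⟩
  have : coshOfSq w = (coshOfSq w - 1) + 1 := by ring
  rw [this]
  exact (IsUltrametricDist.norm_add_le_max _ _).trans (max_le (h1.trans (by norm_num)) (by rw [norm_one]))

/-! ### §2 The Tate sigma product `Π = ∏_{n ≥ 1} (1 − 2qⁿc + q²ⁿ)²/(1 − qⁿ)⁴` (verbatim `p = 5` twins) -/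

/-- `‖1 − Q‖ = 1` for `‖Q‖ < 1`. [folklore] -/
private theorem norm_one_sub_eq_one {Q : ℚ_[5]} (hQ : ‖Q‖ < 1) : ‖1 - Q‖ = 1 := by
  have h : ‖((1 : ℚ_[5]) - Q) - 1‖ < ‖(1 : ℚ_[5])‖ := by
    rw [show ((1 : ℚ_[5]) - Q) - 1 = -Q by ring, norm_neg, norm_one]; exact hQ
  rw [Padic.norm_eq_of_norm_sub_lt_right h, norm_one]

/-- **Each sigma factor is `1 + O(qⁿ(c − 1))`**: for `‖Q‖ < 1` and `‖c‖ ≤ 1`,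
`‖(1 − 2Qc + Q²)²/(1 − Q)⁴ − 1‖ ≤ ‖Q‖·‖c − 1‖`. [cite: SteinWuthrich2013, §4.2] -/
theorem norm_tateSigmaSq_factor_sub_one_le {Q c : ℚ_[5]} (hQ : ‖Q‖ < 1) (hc : ‖c‖ ≤ 1) :
    ‖(1 - 2 * Q * c + Q ^ 2) ^ 2 / (1 - Q) ^ 4 - 1‖ ≤ ‖Q‖ * ‖c - 1‖ := by
  have hB : ‖(1 - Q) ^ 4‖ = 1 := by rw [norm_pow, norm_one_sub_eq_one hQ, one_pow]
  have hB0 : (1 - Q) ^ 4 ≠ 0 := by intro h; rw [h, norm_zero] at hB; exact zero_ne_one hB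
  rw [div_sub_one hB0, norm_div, hB, div_one]
  have hfac : (1 - 2 * Q * c + Q ^ 2) ^ 2 - (1 - Q) ^ 4 =
      (-2 * Q * (c - 1)) * ((1 - 2 * Q * c + Q ^ 2) + (1 - Q) ^ 2) := by ring
  rw [hfac, norm_mul]
  have h2 : ‖(-2 : ℚ_[5])‖ ≤ 1 := by
    rw [show (-2 : ℚ_[5]) = ((-2 : ℤ) : ℚ_[5]) by norm_cast]; exact Padic.norm_int_le_one _
  have hQ1 : ‖Q‖ ≤ 1 := hQ.le
  have hsum : ‖(1 - 2 * Q * c + Q ^ 2) + (1 - Q) ^ 2‖ ≤ 1 := by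
    refine (IsUltrametricDist.norm_add_le_max _ _).trans (max_le ?_ ?_)
    · refine (IsUltrametricDist.norm_add_le_max _ _).trans (max_le ?_ ?_)
      · refine (norm_sub_le_max₅ _ _).trans (max_le (by rw [norm_one]) ?_)
        rw [norm_mul, norm_mul]
        calc ‖(2 : ℚ_[5])‖ * ‖Q‖ * ‖c‖ ≤ 1 * 1 * 1 := by
              gcongr
              rw [show (2 : ℚ_[5]) = ((2 : ℤ) : ℚ_[5]) by norm_cast]; exact Padic.norm_int_le_one _
          _ = 1 := by norm_num
      · rw [norm_pow]; exact pow_le_one₀ (norm_nonneg _) hQ1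
    · rw [norm_pow, norm_one_sub_eq_one hQ, one_pow]
  calc ‖-2 * Q * (c - 1)‖ * ‖(1 - 2 * Q * c + Q ^ 2) + (1 - Q) ^ 2‖ ≤ ‖-2 * Q * (c - 1)‖ * 1 := by gcongr
    _ = ‖(-2 : ℚ_[5])‖ * (‖Q‖ * ‖c - 1‖) := by rw [mul_one, norm_mul, norm_mul, mul_assoc]
    _ ≤ 1 * (‖Q‖ * ‖c - 1‖) := by gcongr
    _ = ‖Q‖ * ‖c - 1‖ := one_mul _

/-- The sigma factors are multipliable for `‖q‖ < 1`, `‖c‖ ≤ 1` (geometric majorant of `Σ ‖f_n − 1‖`). [folklore] -/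
theorem multipliable_tateSigmaSq_factor {q c : ℚ_[5]} (hq : ‖q‖ < 1) (hc : ‖c‖ ≤ 1) :
    Multipliable fun n : ℕ ↦ (1 - 2 * q ^ (n + 1) * c + q ^ (2 * (n + 1))) ^ 2 / (1 - q ^ (n + 1)) ^ 4 := by
  have heq : (fun n : ℕ ↦ (1 - 2 * q ^ (n + 1) * c + q ^ (2 * (n + 1))) ^ 2 / (1 - q ^ (n + 1)) ^ 4) =
      fun n : ℕ ↦ 1 + ((1 - 2 * q ^ (n + 1) * c + (q ^ (n + 1)) ^ 2) ^ 2 / (1 - q ^ (n + 1)) ^ 4 - 1) := by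
    funext n; rw [← pow_mul, mul_comm (n + 1) 2]; ring
  rw [heq]
  refine multipliable_one_add_of_summable ?_
  refine Summable.of_nonneg_of_le (fun _ ↦ norm_nonneg _) (fun n ↦ ?_)
    (((summable_geometric_of_lt_one (norm_nonneg q) hq).mul_right ‖q‖).mul_right ‖c - 1‖)
  have hqn : ‖q ^ (n + 1)‖ < 1 := by rw [norm_pow]; exact pow_lt_one₀ (norm_nonneg _) hq (by omega)
  refine (norm_tateSigmaSq_factor_sub_one_le hqn hc).trans (le_of_eq ?_)
  rw [norm_pow, pow_succ]

/-- **`‖Π − 1‖ ≤ ‖q‖·‖c − 1‖`** for the Tate sigma product (`‖q‖ < 1`, `‖c‖ ≤ 1`): every partial product is within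
`‖q‖·‖c − 1‖` of `1` (`norm_prod_sub_prod_le`), pass to the limit. [cite: SteinWuthrich2013, §4.2] -/
theorem norm_tprod_tateSigmaSq_factor_sub_one_le {q c : ℚ_[5]} (hq : ‖q‖ < 1) (hc : ‖c‖ ≤ 1) :
    ‖(∏' n : ℕ, (1 - 2 * q ^ (n + 1) * c + q ^ (2 * (n + 1))) ^ 2 / (1 - q ^ (n + 1)) ^ 4) - 1‖ ≤
      ‖q‖ * ‖c - 1‖ := by
  have hP0 := (multipliable_tateSigmaSq_factor hq hc).hasProd
  have h1 : Tendsto (fun s : Finset ℕ ↦ ∏ n ∈ s, (1 : ℚ_[5])) atTop (𝓝 1) := by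
    simp only [Finset.prod_const_one]; exact tendsto_const_nhds
  have hP := (hP0.sub h1).norm
  refine le_of_tendsto' hP fun s ↦ ?_
  have hC : 0 ≤ ‖q‖ * ‖c - 1‖ := by positivity
  refine norm_prod_sub_prod_le hC (fun n ↦ ?_) (fun _ ↦ by rw [norm_one]) (fun n ↦ ?_) s
  · have hqn : ‖q ^ (n + 1)‖ < 1 := by rw [norm_pow]; exact pow_lt_one₀ (norm_nonneg _) hq (by omega)
    have h := norm_tateSigmaSq_factor_sub_one_le hqn hc
    have hlt : ‖(1 - 2 * q ^ (n + 1) * c + (q ^ (n + 1)) ^ 2) ^ 2 / (1 - q ^ (n + 1)) ^ 4 - 1‖ < 1 := by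
      refine h.trans_lt ?_
      calc ‖q ^ (n + 1)‖ * ‖c - 1‖ ≤ ‖q ^ (n + 1)‖ * 1 := by
            gcongr
            refine (norm_sub_le_max₅ c 1).trans (max_le hc (by rw [norm_one]))
        _ < 1 := by rw [mul_one]; exact hqn
    have heq : (1 - 2 * q ^ (n + 1) * c + q ^ (2 * (n + 1))) ^ 2 / (1 - q ^ (n + 1)) ^ 4 =
        (1 - 2 * q ^ (n + 1) * c + (q ^ (n + 1)) ^ 2) ^ 2 / (1 - q ^ (n + 1)) ^ 4 := by
      rw [← pow_mul, mul_comm (n + 1) 2]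
    rw [heq, (Padic.norm_eq_of_norm_sub_lt_right (hlt.trans_eq norm_one.symm)), norm_one]
  · have hqn : ‖q ^ (n + 1)‖ < 1 := by rw [norm_pow]; exact pow_lt_one₀ (norm_nonneg _) hq (by omega)
    have heq : (1 - 2 * q ^ (n + 1) * c + q ^ (2 * (n + 1))) ^ 2 / (1 - q ^ (n + 1)) ^ 4 =
        (1 - 2 * q ^ (n + 1) * c + (q ^ (n + 1)) ^ 2) ^ 2 / (1 - q ^ (n + 1)) ^ 4 := by
      rw [← pow_mul, mul_comm (n + 1) 2]
    rw [heq]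
    refine (norm_tateSigmaSq_factor_sub_one_le hqn hc).trans ?_
    rw [norm_pow, pow_succ]
    calc ‖q‖ ^ n * ‖q‖ * ‖c - 1‖ ≤ 1 * ‖q‖ * ‖c - 1‖ := by
          gcongr; exact pow_le_one₀ (norm_nonneg _) hq.le
      _ = ‖q‖ * ‖c - 1‖ := by rw [one_mul]

/-- **`σ_q²(ch(w)) = w + O(5⁻⁸)`**: for `‖q‖₅ < 1` and `‖w‖₅ ≤ 5⁻⁴`, `‖tateSigmaSq q (coshOfSq w) − w‖₅ ≤ 5⁻⁸`
(`σ² = 2(c − 1)·Π` with `‖2(c − 1) − w‖ ≤ 5⁻⁸`, `‖Π − 1‖ ≤ 5⁻¹·5⁻⁴`, `‖w‖ ≤ 5⁻⁴`). At this precision the whole sigma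
function is its leading term `log_Ŵ(z)²/C²`. [cite: SteinWuthrich2013, §4.2] -/
theorem norm_tateSigmaSq_coshOfSq_sub_le {q w : ℚ_[5]} (hq : ‖q‖ < 1) (hw : ‖w‖ ≤ 1 / 625) :
    ‖tateSigmaSq q (coshOfSq w) - w‖ ≤ 1 / 5 ^ 8 := by
  set c := coshOfSq w with hc
  obtain ⟨hc1, hcle⟩ := norm_coshOfSq_sub_one_le hw
  have hch := norm_coshOfSq_sub_le hw
  have hq5 : ‖q‖ ≤ 1 / 5 := norm_le_fifth_of_norm_lt_one hq
  set P := ∏' n : ℕ, (1 - 2 * q ^ (n + 1) * c + q ^ (2 * (n + 1))) ^ 2 / (1 - q ^ (n + 1)) ^ 4 with hP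
  have hP1 : ‖P - 1‖ ≤ 1 / 5 ^ 5 := by
    refine (norm_tprod_tateSigmaSq_factor_sub_one_le hq hcle).trans ?_
    calc ‖q‖ * ‖c - 1‖ ≤ 1 / 5 * (1 / 625) := by gcongr
      _ = 1 / 5 ^ 5 := by norm_num
  have hPle : ‖P‖ ≤ 1 := by
    have : P = (P - 1) + 1 := by ring
    rw [this]
    exact (IsUltrametricDist.norm_add_le_max _ _).trans (max_le (hP1.trans (by norm_num)) (by rw [norm_one]))
  have hdef : tateSigmaSq q c = 2 * (c - 1) * P := by rw [tateSigmaSq]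
  have hsplit : tateSigmaSq q c - w = (2 * (c - (1 + w / 2))) * P + w * (P - 1) := by rw [hdef]; ring
  rw [hsplit]
  refine (IsUltrametricDist.norm_add_le_max _ _).trans (max_le ?_ ?_)
  · rw [norm_mul, norm_mul]
    have h2 : ‖(2 : ℚ_[5])‖ ≤ 1 := by
      rw [show (2 : ℚ_[5]) = ((2 : ℤ) : ℚ_[5]) by norm_cast]; exact Padic.norm_int_le_one _
    calc ‖(2 : ℚ_[5])‖ * ‖c - (1 + w / 2)‖ * ‖P‖ ≤ 1 * (1 / 5 ^ 8) * 1 := by gcongr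
      _ = 1 / 5 ^ 8 := by norm_num
  · rw [norm_mul]
    calc ‖w‖ * ‖P - 1‖ ≤ 1 / 625 * (1 / 5 ^ 5) := by gcongr
      _ ≤ 1 / 5 ^ 8 := by norm_num

end Summit.BirchSwinnertonDyer.Rank1Residual.X11b.RegMult.KernelCertFive
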